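import Summits.KontsevichZagierPeriods.KontsevichZagierPeriods.Theorems.SoloBlindBetaRegions
import Summits.KontsevichZagierPeriods.KontsevichZagierPeriods.Theorems.SoloBlindBetaReflection
import HarnessLib

/-!
# Reflection regions: `{yⁿ ≤ xᵐ(1-x)ⁿ⁻ᵐ}` lies in the cell span

For `0 < m < n` the `ℚ`-rational planar region

  `R_{m,n-m;n} = {(x,y) | 0 < x < 1, 0 ≤ y, yⁿ ≤ xᵐ(1-x)ⁿ⁻ᵐ}`

has class `β(m/n + 1, 2 - m/n)` (`SoloBlindBetaRegions`: one Newton–Leibniz move).  Two Beta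
translations and a symmetry (integration by parts inside the rules) bring it to the reflection
value `β(m/n, 1-m/n) = (1/sin(πm/n))•x_π` (`SoloBlindBetaReflection`: a rational chart onto an
arctangent cell sum).  Hence

* **`[R_{m,n-m;n}] = (m(n-m)/(2n² sin(πm/n)))•x_π`** (`mkQ_reflRegion`) — the region lies in the
  cell span `V`, and its area `π·m(n-m)/(2n² sin(πm/n))` is read off from the moves;
* **the Kontsevich–Zagier conjecture holds for `R_{m,n-m;n}`** against every representation with
  class in `V` (`kz_reflRegion`); in particular any two of these regions, discs, triangles and
  arctangent cells with equal area are equivalent (`kz_reflRegion_reflRegion`).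

`m = 1, n = 2` is the half disc (`⅛x_π`); `m = 1, n = 4` gives `{y⁴ ≤ x(1-x)³}` with class
`(3√2/32)•x_π`.

References: Kontsevich–Zagier, *Periods* (2001), §1.1–1.2. -/

noncomputable section

namespace Summit.KontsevichZagierPeriods.KontsevichZagierPeriods.Theorems

open Set MeasureTheory
open Literature.NumberTheory.Transcendental
open Literature.NumberTheory.Transcendental.KZ

namespace SoloBlind

variable {p n : ℕ}

/-- **`β(m/n+1, 2-m/n) = (m/n)(1-m/n)/2 · (1/sin(πm/n)) • x_π`**: two translations and a symmetry
on top of the reflection formula, all inside the rules. -/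
theorem betaQ_reflection_succ (hp : 0 < p) (hpn : p < n) :
    betaQ ((p : ℚ) / n + 1) (1 - (p : ℚ) / n + 1) =
      ((((p : ℚ) / n * (1 - (p : ℚ) / n) / 2 : ℚ) : K₀) * reflCoeff p n) • xPi := by
  obtain ⟨ha, hb⟩ := refl_exponents_pos hp hpn
  have ha1 : 0 < (p : ℚ) / n + 1 := by linarith
  have hb1 : 0 < 1 - (p : ℚ) / n + 1 := by linarith
  have h1 := betaQ_transl ha hb
  rw [show ((p : ℚ) / n + (1 - (p : ℚ) / n) : ℚ) = 1 by ring, Rat.cast_one, one_smul,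
    betaQ_reflection hp hpn] at h1
  have h2 := betaQ_transl hb1 ha
  rw [show (1 - (p : ℚ) / n + 1 + (p : ℚ) / n : ℚ) = 2 by ring, betaQ_symm hb1 ha, h1,
    betaQ_symm hb1 ha1, smul_smul] at h2
  have h3 := congrArg (fun q : Q => (((1:ℚ) / 2 : ℚ) : K₀) • q) h2
  simp only [smul_smul, ← mul_assoc, ← Rat.cast_mul, show ((1:ℚ) / 2 * 2 : ℚ) = 1 by norm_num,
    Rat.cast_one, one_smul] at h3
  rw [h3]
  congr 2
  ring

variable (m k : ℕ)

/-- The translated second parameter: `(n-m)/n + 1 = 1 - m/n + 1` for `m ≤ n = k+1`. -/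
theorem betaE_sub (hm : m ≤ k + 1) :
    betaE (k + 1 - m) k = 1 - (m : ℚ) / ((k + 1 : ℕ) : ℚ) + 1 := by
  rw [betaE, Nat.cast_sub hm]
  push_cast
  field_simp

/-- The first parameter: `m/n + 1`. -/
theorem betaE_eq_div : betaE m k = (m : ℚ) / ((k + 1 : ℕ) : ℚ) + 1 := by
  rw [betaE]; push_cast; ring

/-- The coefficient `m(n-m)/(2n²) · 1/sin(πm/n) ∈ K₀`. -/
def reflRegionCoeff : K₀ :=
  ((((m : ℚ) / (k + 1) * (1 - (m : ℚ) / (k + 1)) / 2 : ℚ) : K₀) * reflCoeff m (k + 1))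

/-- **`[R_{m,n-m;n}] = (m(n-m)/(2n² sin(πm/n)))•x_π`** in `Q`, for `0 < m < n = k+1`. -/
theorem mkQ_reflRegion (hm : 0 < m) (hmk : m < k + 1) :
    mkQ (of (betaRegion m (k + 1 - m) k)) = reflRegionCoeff m k • xPi := by
  rw [mkQ_betaRegion, betaE_sub m k hmk.le, betaE_eq_div, betaQ_reflection_succ hm hmk,
    reflRegionCoeff]
  push_cast
  rfl

/-- `R_{m,n-m;n}` lies in the cell span `V`. -/
theorem mkQ_reflRegion_mem_cellSpan (hm : 0 < m) (hmk : m < k + 1) :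
    mkQ (of (betaRegion m (k + 1 - m) k)) ∈ cellSpan := by
  rw [mkQ_reflRegion m k hm hmk]
  exact Submodule.smul_mem _ _ xPi_mem_cellSpan

/-- **`area(R_{m,n-m;n}) = π · m(n-m) / (2n² sin(πm/n))`**, read off from the moves. -/
theorem reflRegion_value (hm : 0 < m) (hmk : m < k + 1) :
    (betaRegion m (k + 1 - m) k).value =
      (m : ℝ) / (k + 1) * (1 - (m : ℝ) / (k + 1)) / 2 *
        (Real.sin (Real.pi * ((m : ℝ) / ((k + 1 : ℕ) : ℝ))))⁻¹ * Real.pi := by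
  have h := congrArg evalQ (mkQ_reflRegion m k hm hmk)
  rw [evalQ_mkQ, eval_of, evalQ_smul, evalQ_xPi, reflRegionCoeff, IntermediateField.coe_mul,
    coe_reflCoeff, coe_ratCast_K₀] at h
  rw [h]
  push_cast
  ring

/-- **The Kontsevich–Zagier conjecture for `R_{m,n-m;n}`** against every representation with
class in `V` (Baker). -/
theorem kz_reflRegion (hm : 0 < m) (hmk : m < k + 1) {d : ℕ} (r' : IntegralRep d)
    (hr' : mkQ (of r') ∈ cellSpan) (hv : (betaRegion m (k + 1 - m) k).value = r'.value) :
    Equivalent (betaRegion m (k + 1 - m) k) r' := by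
  rw [Equivalent, ← mkQ_eq_mkQ_iff, ← sub_eq_zero]
  exact eq_zero_of_mem_cellSpan (sub_mem (mkQ_reflRegion_mem_cellSpan m k hm hmk) hr')
    (by rw [map_sub, evalQ_mkQ, evalQ_mkQ, eval_of, eval_of, hv, sub_self])

/-- **Unconditional instance of the conjecture**: two reflection regions with the same area are
equivalent. -/
theorem kz_reflRegion_reflRegion (hm : 0 < m) (hmk : m < k + 1) {m' k' : ℕ} (hm' : 0 < m')
    (hmk' : m' < k' + 1)
    (hv : (betaRegion m (k + 1 - m) k).value = (betaRegion m' (k' + 1 - m') k').value) :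
    Equivalent (betaRegion m (k + 1 - m) k) (betaRegion m' (k' + 1 - m') k') :=
  kz_reflRegion m k hm hmk _ (mkQ_reflRegion_mem_cellSpan m' k' hm' hmk') hv

/-- Example: `{y⁴ ≤ x(1-x)³}` has class `(3√2/32)•x_π`. -/
theorem mkQ_reflRegion_one_three :
    mkQ (of (betaRegion 1 3 3)) = ((((3:ℚ) / 32 : ℚ) : K₀) * reflCoeff 1 4) • xPi := by
  have h := mkQ_reflRegion 1 3 one_pos (by norm_num)
  rw [reflRegionCoeff] at h
  rw [show (3:ℕ) = 3 + 1 - 1 from rfl, h]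
  congr 2
  norm_num

end SoloBlind

end Summit.KontsevichZagierPeriods.KontsevichZagierPeriods.Theorems
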